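import Literature.NumberTheory.Sieve.AletheiaZomleferFukshanskyGarcia2020ApplicationsArithProgProofs
import Literature.NumberTheory.Sieve.ParityWave0Proofs
import Literature.NumberTheory.Sieve.BatemanHornProofs
import HarnessLib

/-!
# SoloInformedLinearBatemanHorn — the `k = 1`, degree-one slice of the conjunct is a theorem

Solo unit `solo-Parity-informed` (ideation tier, informed mode), session 28; `PLAN.md` §36, CLAIMS C107.

The conjunct `BatemanHorn` of the summit is `∀ k (f : Fin k → ℤ[X]), IsBatemanHornSystem f →
BatemanHornAsymptotic f`.  Besides the empty system (`batemanHornAsymptotic_of_isEmpty`, C69) the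
only slice that is a theorem of analytic number theory is `k = 1`, `deg f₀ = 1`: Dirichlet /
de la Vallée-Poussin.  This file puts that slice in the kernel, *for every* Bateman–Horn system of
the slice (arbitrary sign of the constant coefficient), by three steps:

* `batemanHornAsymptotic_linear` — for `a ≥ 1`, `gcd(a, b) = 1`, `a, b ∈ ℕ`:
  `BatemanHornAsymptotic ![aX + b]`, i.e. `#{n ≤ x : an + b prime} ~ (a/φ(a)) · x / log x`, from the
  tree's prime number theorem for progressions `π(N; a, b) log N / N → 1/φ(a)`
  (`Literature.NumberTheory.Sieve.tendsto_primeCountingMod_mul_log_div`) along `N = ax + b`, the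
  count comparison `Q(f; x) ≤ π(ax + b; a, b) ≤ Q(f; x) + b` and the constant `C(aX + b) = a/φ(a)`
  of `AletheiaZomleferFukshanskyGarcia2020Applications(ArithProgProofs)`;
* `batemanHornAsymptotic_of_comp_X_add_natCast` — **translation invariance**: for a Bateman–Horn
  system `f` and `n₀ ∈ ℕ`, `BatemanHornAsymptotic (fᵢ(X + n₀))ᵢ → BatemanHornAsymptotic f`
  (`ω_f(p)` is translation invariant by `p`-periodicity of `n ↦ F(n) mod p`; the prime counts differ
  by the constant `#{n < n₀ : all fᵢ(n) prime}`, which is `o` of a main term tending to `∞` — this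
  uses `C(f) > 0`, i.e. the Bateman–Horn hypotheses; for degenerate families with a fixed prime
  divisor the typed asymptotic is *not* translation invariant);
* `batemanHornAsymptotic_of_natDegree_eq_one` — every Bateman–Horn system `f : Fin 1 → ℤ[X]` with
  `deg f₀ = 1` is `aX + b` with `a ≥ 1`, `gcd(a, b) = 1` (Gauss: irreducible of positive degree is
  primitive), and after the translation `n ↦ n + |b|` its constant coefficient is `≥ 0`.

Statement-audit value: a non-vacuous instance of `BatemanHornAsymptotic` with the tree's exact
normalisations (`polyPrimeCount` over `0 ≤ n ≤ x`, the constant `C/∏ deg fᵢ`, the power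
`(log x)^k`) is certified, so the conjunct is not mis-typed on its one decidable slice.
-/

namespace Summit.Parity.BatemanHorn.Theorems

open Finset Filter Asymptotics Polynomial
open scoped Topology
open Literature.NumberTheory.Sieve (polyRootCountMod polyPrimeCount batemanHornPartial
  HasBatemanHornConst IsBatemanHornSystem batemanHornConst BatemanHornAsymptotic)

section Translation

variable {ι : Type*} [Fintype ι]

/-- `ω` is translation invariant: `ω_{f(· + n₀)}(p) = ω_f(p)`, by `p`-periodicity of
`n ↦ [p ∣ F(n)]`. -/
theorem polyRootCountMod_comp_X_add_natCast (f : ι → ℤ[X]) (n₀ p : ℕ) :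
    polyRootCountMod (fun i => (f i).comp (X + C (n₀ : ℤ))) p = polyRootCountMod f p := by
  unfold polyRootCountMod
  simp only [eval_comp, eval_add, eval_X, eval_C]
  have hper : Function.Periodic (fun m : ℕ => (p : ℤ) ∣ ∏ i, (f i).eval (m : ℤ)) p := fun m => by
    simp only [Nat.cast_add]
    apply propext
    apply dvd_iff_dvd_of_dvd_sub
    rw [← eval_prod, ← eval_prod]
    simpa using sub_dvd_eval_sub ((m : ℤ) + p) (m : ℤ) (∏ i, f i)
  calc #((range p).filter fun n : ℕ => (p : ℤ) ∣ ∏ i, (f i).eval ((n : ℤ) + n₀))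
      = #((range p).filter fun n : ℕ => (p : ℤ) ∣ ∏ i, (f i).eval (((n + n₀ : ℕ) : ℤ))) := by
        simp only [Nat.cast_add]
    _ = #(((range p).filter fun n : ℕ =>
          (p : ℤ) ∣ ∏ i, (f i).eval (((n + n₀ : ℕ) : ℤ))).image (· + n₀)) :=
        (card_image_of_injective _ (add_left_injective n₀)).symm
    _ = #(((range p).image (· + n₀)).filter fun m : ℕ => (p : ℤ) ∣ ∏ i, (f i).eval (m : ℤ)) := by
        rw [filter_image]
    _ = #((Ico n₀ (n₀ + p)).filter fun m : ℕ => (p : ℤ) ∣ ∏ i, (f i).eval (m : ℤ)) := by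
        rw [range_eq_Ico, image_add_right_Ico, zero_add, add_comm]
    _ = p.count fun m : ℕ => (p : ℤ) ∣ ∏ i, (f i).eval (m : ℤ) :=
        Nat.filter_Ico_card_eq_of_periodic n₀ p _ hper
    _ = #((range p).filter fun m : ℕ => (p : ℤ) ∣ ∏ i, (f i).eval (m : ℤ)) :=
        Nat.count_eq_card_filter_range _ p

/-- The Bateman–Horn partial products are translation invariant. -/
theorem batemanHornPartial_comp_X_add_natCast (f : ι → ℤ[X]) (n₀ : ℕ) :
    batemanHornPartial (fun i => (f i).comp (X + C (n₀ : ℤ))) = batemanHornPartial f := by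
  funext x
  unfold batemanHornPartial
  simp_rw [polyRootCountMod_comp_X_add_natCast]

/-- `HasBatemanHornConst` is translation invariant. -/
theorem hasBatemanHornConst_comp_X_add_natCast (f : ι → ℤ[X]) (n₀ : ℕ) (C₀ : ℝ) :
    HasBatemanHornConst (fun i => (f i).comp (X + C (n₀ : ℤ))) C₀ ↔ HasBatemanHornConst f C₀ := by
  unfold HasBatemanHornConst
  rw [batemanHornPartial_comp_X_add_natCast]

/-- The prime-value counts of `f` and of its translate differ by a constant:
`P_f(x + n₀) = P_{f(· + n₀)}(x) + #{n < n₀ : every fᵢ(n) is (positive and) prime}`. -/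
theorem polyPrimeCount_add_eq (f : ι → ℤ[X]) (n₀ x : ℕ) :
    polyPrimeCount f (x + n₀) = polyPrimeCount (fun i => (f i).comp (X + C (n₀ : ℤ))) x +
      #((range n₀).filter fun n : ℕ =>
        ∀ i, 0 < (f i).eval (n : ℤ) ∧ ((f i).eval (n : ℤ)).toNat.Prime) := by
  unfold polyPrimeCount
  simp only [eval_comp, eval_add, eval_X, eval_C]
  rw [show x + n₀ + 1 = n₀ + (x + 1) by omega, range_add_eq_union, filter_union,
    card_union_of_disjoint (disjoint_filter_filter (disjoint_range_addLeftEmbedding _ _))]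
  suffices h : #((map (addLeftEmbedding n₀) (range (x + 1))).filter fun n : ℕ =>
        ∀ i, 0 < (f i).eval (n : ℤ) ∧ ((f i).eval (n : ℤ)).toNat.Prime) =
      #((range (x + 1)).filter fun n : ℕ =>
        ∀ i, 0 < (f i).eval ((n : ℤ) + n₀) ∧ ((f i).eval ((n : ℤ) + n₀)).toNat.Prime) by
    omega
  rw [filter_map, card_map]
  refine congr_arg Finset.card (filter_congr fun n _ => ?_)
  simp only [Function.comp_apply, addLeftEmbedding_apply, Nat.cast_add, add_comm]

/-- **Translation invariance of the Bateman–Horn asymptotic (for Bateman–Horn systems).**  If the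
translate `(fᵢ(X + n₀))ᵢ` satisfies the Bateman–Horn asymptotic then so does `f`.  (The constant
`C(f) > 0` of a Bateman–Horn system makes the main term tend to `∞`, which absorbs the constant
discrepancy of the counts; without the Bateman–Horn hypotheses this fails, e.g. for `X² + X + 2`.) -/
theorem batemanHornAsymptotic_of_comp_X_add_natCast {f : ι → ℤ[X]} (hf : IsBatemanHornSystem f)
    (n₀ : ℕ) (h : BatemanHornAsymptotic (fun i => (f i).comp (X + C (n₀ : ℤ)))) :
    BatemanHornAsymptotic f := by
  obtain ⟨C₀, hC₀, hP⟩ := h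
  rw [hasBatemanHornConst_comp_X_add_natCast] at hC₀
  obtain ⟨hCf, hpos⟩ := IsBatemanHornSystem.hasBatemanHornConst_holds hf
  have hCeq : C₀ = batemanHornConst f := tendsto_nhds_unique hC₀ hCf
  refine ⟨C₀, hC₀, ?_⟩
  set g : ℕ → ℝ := fun x : ℕ =>
    C₀ / (∏ i, ((f i).natDegree : ℝ)) * (x : ℝ) / Real.log (x : ℝ) ^ Fintype.card ι with hg
  have hdeg : ∀ i, ((f i).comp (X + C (n₀ : ℤ))).natDegree = (f i).natDegree := fun i => by
    rw [natDegree_comp, natDegree_X_add_C, mul_one]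
  have hKpos : 0 < C₀ / ∏ i, ((f i).natDegree : ℝ) := by
    have : 0 < ∏ i, ((f i).natDegree : ℝ) :=
      prod_pos fun i _ => by exact_mod_cast hf.natDegree_pos i
    rw [hCeq]
    exact div_pos hpos this
  -- the translate's count is `~ g`
  have hP' : (fun x : ℕ => (polyPrimeCount (fun i => (f i).comp (X + C (n₀ : ℤ))) x : ℝ))
      ~[atTop] g := by
    refine hP.congr_right (Eventually.of_forall fun x => ?_)
    simp only [hg, hdeg]
  -- `g (y - n₀) ~ g y`
  have hsub : (fun y : ℕ => (((y - n₀ : ℕ) : ℝ))) ~[atTop] fun y : ℕ => (y : ℝ) := by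
    have := Literature.NumberTheory.Sieve.isEquivalent_mul_sub_div 1 n₀ one_pos
    simpa [Nat.div_one] using this
  have hlog : (fun y : ℕ => Real.log ((y - n₀ : ℕ) : ℝ)) ~[atTop] fun y : ℕ => Real.log y := by
    have := Literature.NumberTheory.Sieve.isEquivalent_log_sub_div 1 n₀ one_pos
    simpa [Nat.div_one] using this
  have hgsub : (fun y : ℕ => g (y - n₀)) ~[atTop] g := by
    have h1 := ((IsEquivalent.refl (u := fun _ : ℕ => C₀ / ∏ i, ((f i).natDegree : ℝ))).mul
      hsub).div (hlog.pow (Fintype.card ι))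
    refine (h1.congr_left (Eventually.of_forall fun y => ?_)).congr_right
      (Eventually.of_forall fun y => ?_)
    · simp only [Pi.div_apply, Pi.mul_apply, Pi.pow_apply, hg, mul_div_assoc]
    · simp only [Pi.div_apply, Pi.mul_apply, Pi.pow_apply, hg, mul_div_assoc]
  -- `g → ∞`
  have hratio : Tendsto (fun x : ℝ => Real.log x ^ Fintype.card ι / x) atTop (𝓝[>] 0) := by
    refine tendsto_nhdsWithin_iff.2 ⟨?_, ?_⟩
    · simpa [one_mul, add_zero] using
        Real.tendsto_pow_log_div_mul_add_atTop 1 0 (Fintype.card ι) one_ne_zero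
    · filter_upwards [eventually_gt_atTop 1] with x hx
      exact Set.mem_Ioi.2 (div_pos (pow_pos (Real.log_pos hx) _) (by linarith))
  have hg_top : Tendsto g atTop atTop := by
    have h1 : Tendsto (fun x : ℝ => C₀ / (∏ i, ((f i).natDegree : ℝ)) *
        (Real.log x ^ Fintype.card ι / x)⁻¹) atTop atTop :=
      (tendsto_inv_nhdsGT_zero.comp hratio).const_mul_atTop hKpos
    refine (h1.comp tendsto_natCast_atTop_atTop).congr fun x => ?_
    simp only [hg, Function.comp_apply, inv_div]
    ring
  -- the counts of `f` and of the translate differ by a constant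
  have hPf : ∀ᶠ y : ℕ in atTop, (polyPrimeCount f y : ℝ) =
      (polyPrimeCount (fun i => (f i).comp (X + C (n₀ : ℤ))) (y - n₀) : ℝ) +
        (#((range n₀).filter fun n : ℕ =>
          ∀ i, 0 < (f i).eval (n : ℤ) ∧ ((f i).eval (n : ℤ)).toNat.Prime) : ℝ) := by
    filter_upwards [eventually_ge_atTop n₀] with y hy
    have := polyPrimeCount_add_eq f n₀ (y - n₀)
    rw [Nat.sub_add_cancel hy] at this
    exact_mod_cast this
  have hmain : (fun y : ℕ =>
      (polyPrimeCount (fun i => (f i).comp (X + C (n₀ : ℤ))) (y - n₀) : ℝ)) ~[atTop] g :=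
    (hP'.comp_tendsto (tendsto_sub_atTop_nat n₀)).trans hgsub
  have hc₀ : (fun _ : ℕ => (#((range n₀).filter fun n : ℕ =>
      ∀ i, 0 < (f i).eval (n : ℤ) ∧ ((f i).eval (n : ℤ)).toNat.Prime) : ℝ)) =o[atTop] g :=
    isLittleO_const_left.2 (Or.inr (tendsto_norm_atTop_atTop.comp hg_top))
  exact (hmain.add_isLittleO hc₀).congr_left (hPf.mono fun y hy => by
    simp only [Pi.add_apply]; exact hy.symm)

end Translation

/-! ### The slice `k = 1`, `deg = 1` -/

/-- **Dirichlet–de la Vallée-Poussin in Bateman–Horn form.**  For `a ≥ 1`, `gcd(a, b) = 1`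
(`a, b ∈ ℕ`): `#{n ≤ x : an + b prime} ~ (a/φ(a)) · x/log x`, i.e. `BatemanHornAsymptotic ![aX + b]`
with the tree's constant `C(aX + b) = a/φ(a)` (`hasBatemanHornConst_linear`).  From the tree's
`π(N; a, b) log N / N → 1/φ(a)` along `N = ax + b` and `Q(f; x) ≤ π(ax + b; a, b) ≤ Q(f; x) + b`. -/
theorem batemanHornAsymptotic_linear (a b : ℕ) (ha : 0 < a) (hab : a.Coprime b) :
    BatemanHornAsymptotic ![C (a : ℤ) * X + C (b : ℤ)] := by
  refine ⟨(a : ℝ) / Nat.totient a,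
    Literature.NumberTheory.Sieve.hasBatemanHornConst_linear a b ha hab, ?_⟩
  have hdeg : (C (a : ℤ) * X + C (b : ℤ)).natDegree = 1 :=
    natDegree_linear (by exact_mod_cast ha.ne')
  simp only [Fin.prod_univ_one, Matrix.cons_val_fin_one, hdeg, Fintype.card_fin, pow_one,
    Nat.cast_one, div_one]
  set P : ℕ → ℕ := polyPrimeCount ![C (a : ℤ) * X + C (b : ℤ)] with hPdef
  have hφ : (0 : ℝ) < Nat.totient a := by exact_mod_cast Nat.totient_pos.mpr ha
  have ha' : (0 : ℝ) < a := by exact_mod_cast ha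
  -- count comparison `P x ≤ π(ax + b; a, b) ≤ P x + b`
  have hcmp : ∀ x : ℕ,
      (P x : ℝ) ≤ Literature.NumberTheory.Sieve.ParityWave0.primeCountingMod a b (a * x + b) ∧
      (Literature.NumberTheory.Sieve.ParityWave0.primeCountingMod a b (a * x + b) : ℝ) ≤ P x + b := by
    intro x
    have hx : (a * x + b - b) / a = x := by
      rw [Nat.add_sub_cancel, Nat.mul_div_cancel_left x ha]
    have h1 := Literature.NumberTheory.Sieve.card_linear_le_primeCountingMod a b ha
      (y := a * x + b) (Nat.le_add_left b _)
    have h2 := Literature.NumberTheory.Sieve.primeCountingMod_le_card_linear a b (a * x + b)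
    rw [hx, ← Literature.NumberTheory.Sieve.polyPrimeCount_linear] at h1 h2
    exact ⟨by exact_mod_cast h1, by exact_mod_cast h2⟩
  -- the prime number theorem for progressions along `N = ax + b`
  have hy : Tendsto (fun x : ℕ => a * x + b) atTop atTop := by
    refine tendsto_atTop_atTop.2 fun M => ⟨M, fun x hx => ?_⟩
    calc M ≤ x := hx
      _ ≤ a * x := Nat.le_mul_of_pos_left x ha
      _ ≤ a * x + b := Nat.le_add_right _ _
  have hT := (Literature.NumberTheory.Sieve.tendsto_primeCountingMod_mul_log_div ha.ne'
    hab.symm).comp hy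
  -- `(ax + b)/x → a`
  have h2 : Tendsto (fun x : ℕ => (((a * x + b : ℕ) : ℝ)) / (x : ℝ)) atTop (𝓝 (a : ℝ)) := by
    have : Tendsto (fun x : ℕ => (a : ℝ) + (b : ℝ) / (x : ℝ)) atTop (𝓝 ((a : ℝ) + 0)) :=
      tendsto_const_nhds.add (tendsto_const_div_atTop_nhds_zero_nat (b : ℝ))
    rw [add_zero] at this
    refine this.congr' ?_
    filter_upwards [eventually_gt_atTop 0] with x hx
    have hx' : (x : ℝ) ≠ 0 := by exact_mod_cast hx.ne'
    push_cast
    field_simp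
  -- `log x / log(ax + b) → 1`
  have hlx : Tendsto (fun x : ℕ => Real.log (x : ℝ)) atTop atTop :=
    Real.tendsto_log_atTop.comp tendsto_natCast_atTop_atTop
  have h3 : Tendsto (fun x : ℕ => Real.log (x : ℝ) / Real.log (((a * x + b : ℕ) : ℝ))) atTop
      (𝓝 1) := by
    have hd : Tendsto (fun x : ℕ => Real.log (((a * x + b : ℕ) : ℝ)) - Real.log (x : ℝ)) atTop
        (𝓝 (Real.log a)) := by
      refine (h2.log ha'.ne').congr' ?_
      filter_upwards [eventually_gt_atTop 0] with x hx
      have hx' : (0 : ℝ) < x := by exact_mod_cast hx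
      have hy' : (0 : ℝ) < ((a * x + b : ℕ) : ℝ) := by
        have : 0 < a * x + b := by positivity
        exact_mod_cast this
      rw [Real.log_div hy'.ne' hx'.ne']
    have hq := hd.div_atTop hlx
    have hr : Tendsto (fun x : ℕ => Real.log (((a * x + b : ℕ) : ℝ)) / Real.log (x : ℝ)) atTop
        (𝓝 1) := by
      have := hq.const_add 1
      rw [add_zero] at this
      refine this.congr' ?_
      filter_upwards [eventually_gt_atTop 1] with x hx
      have hlx' : Real.log (x : ℝ) ≠ 0 := (Real.log_pos (by exact_mod_cast hx)).ne'
      field_simp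
      ring
    have := hr.inv₀ one_ne_zero
    simpa [inv_div] using this
  -- the main limit `P x log x / x → a/φ(a)`
  have hlim : Tendsto (fun x : ℕ => (P x : ℝ) * Real.log (x : ℝ) / (x : ℝ)) atTop
      (𝓝 ((a : ℝ) / Nat.totient a)) := by
    have hπ : Tendsto (fun x : ℕ =>
        (Literature.NumberTheory.Sieve.ParityWave0.primeCountingMod a b (a * x + b) : ℝ) *
          Real.log (x : ℝ) / (x : ℝ)) atTop (𝓝 ((a : ℝ) / Nat.totient a)) := by
      have hprod := (hT.mul h2).mul h3
      have hval : ((Nat.totient a : ℝ)⁻¹ * (a : ℝ)) * 1 = (a : ℝ) / Nat.totient a := by ring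
      rw [hval] at hprod
      refine hprod.congr' ?_
      filter_upwards [eventually_gt_atTop 1] with x hx
      have hx2 : 1 < a * x + b := by
        have : x ≤ a * x := Nat.le_mul_of_pos_left x ha
        omega
      have hx0 : (x : ℝ) ≠ 0 := by exact_mod_cast (show x ≠ 0 by omega)
      have hy1 : (1 : ℝ) < ((a * x + b : ℕ) : ℝ) := by exact_mod_cast hx2
      have hlogy : Real.log (((a * x + b : ℕ) : ℝ)) ≠ 0 := (Real.log_pos hy1).ne'
      have hy0 : (((a * x + b : ℕ) : ℝ)) ≠ 0 := by positivity
      simp only [Function.comp_apply]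
      field_simp
    have hrem : Tendsto (fun x : ℕ => ((P x : ℝ) -
        Literature.NumberTheory.Sieve.ParityWave0.primeCountingMod a b (a * x + b)) *
          Real.log (x : ℝ) / (x : ℝ)) atTop (𝓝 0) := by
      have hlx0 : Tendsto (fun x : ℕ => Real.log (x : ℝ) / (x : ℝ)) atTop (𝓝 0) := by
        have := Real.tendsto_pow_log_div_mul_add_atTop 1 0 1 one_ne_zero
        simp only [pow_one, one_mul, add_zero] at this
        exact this.comp tendsto_natCast_atTop_atTop
      have hb0 : Tendsto (fun x : ℕ => (b : ℝ) * (Real.log (x : ℝ) / (x : ℝ))) atTop (𝓝 0) := by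
        simpa using hlx0.const_mul (b : ℝ)
      refine squeeze_zero_norm' ?_ hb0
      filter_upwards [eventually_ge_atTop 1] with x hx
      have hl : 0 ≤ Real.log (x : ℝ) / x :=
        div_nonneg (Real.log_nonneg (by exact_mod_cast hx)) (Nat.cast_nonneg x)
      obtain ⟨h1, h2⟩ := hcmp x
      rw [Real.norm_eq_abs, mul_div_assoc, abs_mul, abs_of_nonneg hl]
      refine mul_le_mul_of_nonneg_right ?_ hl
      rw [abs_le]
      constructor <;> linarith
    have := hπ.add hrem
    rw [add_zero] at this
    refine this.congr' (Eventually.of_forall fun x => ?_)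
    ring
  -- conclusion
  refine isEquivalent_of_tendsto_one ?_
  have := hlim.div_const ((a : ℝ) / Nat.totient a)
  rw [div_self (div_pos ha' hφ).ne'] at this
  refine this.congr' ?_
  filter_upwards [eventually_gt_atTop 1] with x hx
  have hx0 : (x : ℝ) ≠ 0 := by exact_mod_cast (show x ≠ 0 by omega)
  have hlog : Real.log (x : ℝ) ≠ 0 := (Real.log_pos (by exact_mod_cast hx)).ne'
  simp only [Pi.div_apply]
  field_simp

/-- A Bateman–Horn system `f : Fin 1 → ℤ[X]` whose member is literally `aX + b` with `a > 0`,
`b ≥ 0`, `gcd(a, b) = 1` satisfies the asymptotic (cast of `batemanHornAsymptotic_linear`). -/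
theorem batemanHornAsymptotic_of_eq_linear (f : Fin 1 → ℤ[X]) {a b : ℤ}
    (hf0 : f 0 = C a * X + C b) (ha : 0 < a) (hb : 0 ≤ b) (hcop : IsCoprime a b) :
    BatemanHornAsymptotic f := by
  obtain ⟨a', rfl⟩ := Int.eq_ofNat_of_zero_le ha.le
  obtain ⟨b', rfl⟩ := Int.eq_ofNat_of_zero_le hb
  have hfeq : f = ![C (a' : ℤ) * X + C (b' : ℤ)] := by
    funext i
    fin_cases i
    simpa using hf0
  rw [hfeq]
  exact batemanHornAsymptotic_linear a' b' (by exact_mod_cast ha) (Nat.isCoprime_iff_coprime.mp hcop)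

/-- **The `k = 1`, degree-one slice of the Bateman–Horn conjecture is a theorem.**  Every
Bateman–Horn system consisting of one linear polynomial satisfies the Bateman–Horn asymptotic. -/
theorem batemanHornAsymptotic_of_natDegree_eq_one (f : Fin 1 → ℤ[X]) (hf : IsBatemanHornSystem f)
    (h1 : (f 0).natDegree = 1) : BatemanHornAsymptotic f := by
  have hf0 : f 0 = C ((f 0).coeff 1) * X + C ((f 0).coeff 0) := eq_X_add_C_of_natDegree_le_one h1.le
  set a : ℤ := (f 0).coeff 1 with ha_def
  set b : ℤ := (f 0).coeff 0 with hb_def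
  have ha : 0 < a := by
    have h := hf.leadingCoeff_pos 0
    rwa [leadingCoeff, h1] at h
  -- `gcd(a, b) = 1`: an irreducible polynomial of positive degree is primitive
  have hprim : (f 0).IsPrimitive := (hf.irreducible 0).isPrimitive (by omega)
  have hcop : IsCoprime a b := by
    rw [Int.isCoprime_iff_gcd_eq_one]
    have hd : C ((Int.gcd a b : ℕ) : ℤ) ∣ f 0 := by
      refine (C_dvd_iff_dvd_coeff _ _).mpr fun i => ?_
      rcases i with _ | _ | i
      · exact Int.gcd_dvd_right a b
      · exact Int.gcd_dvd_left a b
      · rw [coeff_eq_zero_of_natDegree_lt (by omega)]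
        exact dvd_zero _
    have hu := isPrimitive_iff_isUnit_of_C_dvd.mp hprim _ hd
    simpa using Int.isUnit_iff_natAbs_eq.mp hu
  rcases le_or_gt 0 b with hb | hb
  · exact batemanHornAsymptotic_of_eq_linear f hf0 ha hb hcop
  · -- translate by `n₀ = |b|`: `f₀(X + n₀) = aX + (a n₀ + b)` with `a n₀ + b = (a - 1)|b| ≥ 0`
    set n₀ : ℕ := b.natAbs with hn₀_def
    have hn₀ : (n₀ : ℤ) = -b := by
      rw [hn₀_def, ← Int.natAbs_neg]
      exact Int.natAbs_of_nonneg (by omega)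
    have hshift : (f 0).comp (X + C (n₀ : ℤ)) = C a * X + C (a * n₀ + b) := by
      rw [hf0]
      simp only [add_comp, mul_comp, C_comp, X_comp, map_add, map_mul, map_natCast]
      ring
    refine batemanHornAsymptotic_of_comp_X_add_natCast hf n₀
      (batemanHornAsymptotic_of_eq_linear _ hshift ha ?_ ?_)
    · rw [hn₀]
      nlinarith
    · rw [add_comm]
      exact hcop.add_mul_left_right _

/-- The slice restated against the conjunct's quantifier shape: for `k = 1` and `deg f₀ ≤ 1` the
Bateman–Horn conjecture holds (degree `0` is excluded by the Bateman–Horn hypotheses). -/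
theorem batemanHornConjecture_slice_linear (f : Fin 1 → ℤ[X]) (hf : IsBatemanHornSystem f)
    (h1 : (f 0).natDegree ≤ 1) : BatemanHornAsymptotic f :=
  batemanHornAsymptotic_of_natDegree_eq_one f hf (le_antisymm h1 (hf.natDegree_pos 0))

end Summit.Parity.BatemanHorn.Theorems
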